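import Summits.QuantumFields.BalabanUV.T4Continuum.Support.GaugeTermSlotRateNumbers
import Summits.QuantumFields.BalabanUV.T4Continuum.Support.ScalarCovariantLaplacianLawsRate

/-!
# T⁴ programme, spine node NE2 (U1a), owner row B8 «general rate» (OWNER RULING NE2 R17 (c); closer (M1′) of GAPS § G-ne2leaf08g2-1,
# STRUCTURE half), PART 3b, file 2/2 — ROW B4.b's GAUGE SLOT OF ROOT B AT A GENERAL GEOMETRIC RATE `θ ∈ [L⁻¹, 1]`

NE2 formalisation swarm `b2b-balaban-t4-ne2-formalise-*`, leaf prover 05 (gen 4; the lineage of row B4.b).  APPEND-ONLY TWINS — NO landed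
statement edited, the instance of record (`GaugeTermBalabanData.perturbationLaws_gaugeSlot_data`, rate `L⁻¹`) neither superseded nor weakened.
The slot's chain at rate `L⁻¹` is `GaugeTermInstance.layerLaws_of_scalarLaws` → `GaugeTermInstanceGeom.geomNumbers_of_defects` →
`NE2BalabanGauge.{EGT_le_geom, perturbationLaws_gaugeSlot}` → `GaugeTermInstanceGeom.perturbationLaws_gaugeSlot_scalar(_site)` →
`GaugeTermBalabanData.perturbationLaws_gaugeSlot_data`.  The ONLY places where the rate `L⁻¹` is hard-wired are (i) the two-spacing CONSISTENCY
inputs (`hcons : … ≤ β′/n_k` of the connection, `τ′/n_k` of the site transports — part 3a's `ConnectionLaws0Rate` / `SiteTransportLaws0Rate`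
re-type them `·θ^k`), (ii) the bundle `NE2BalabanGauge.GeomNumbers L …` and `EGT_le_geom` (ratio `L⁻¹` in the statement, although the
estimates they rest on — `zetaL_le_geom`, `nuL_le_geom`, `GaugeTermSandwichLaw.Esand_le_geometric` — are ratio-GENERIC), (iii) the geometric
read-outs `esS_le_geom` / `ecS_le_geom` / `thetaS_le_geom`.  This file supplies the rate-`θ` twins of exactly those and NOTHING else:
 * file 1/2 (`GaugeTermSlotRateNumbers`): the ratio-`θ` number read-outs (`esS_le_geom_rate`, `ecS_le_geom_rate`, `thetaSR`,
   `thetaSR_le_geom`), `GeomNumbersRate θ`, `EGT_le_geom_rate`, `perturbationLaws_gaugeSlot_rate`;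
 * §3 `layerLaws_of_scalarLaws_rate` (my `layerLaws_of_scalarLaws` VERBATIM except the planting field), `geomNumbersRate_of_defects`;
 * §4 the ENDs: `perturbationLaws_gaugeSlot_scalar_rate`, `perturbationLaws_gaugeSlot_scalar_site_rate`, and
   **`perturbationLaws_gaugeSlot_data_rate (hd) (ha′) (hfree) (he₀ : e₀ k ≤ C₀θ^k) (he₁) (hR : ConnectionLaws0Rate … θ) (hT : SiteTransportLaws0Rate … θ)
   (hθ : L⁻¹ ≤ θ) (hθle : θ ≤ 1) (hκ) (hsmall) : PerturbationLaws (Δ_a ⊗ 1) (gaugeSlot L M R (QuT T) Q1 a′) (J ⊗ 1) (kappaGS …) (k ↦ C4S … · θ^k)`** —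
   `GaugeTermBalabanData.perturbationLaws_gaugeSlot_data`'s statement with `θ` for `L⁻¹`: SAME `κ = kappaGS`, SAME `C₄ = C4S` (owner R17 (c):
   «constants pick up at most one factor L» — here none, the `(L+1)`-factors of `C4S` already cover it); and `perturbationLaws_gaugeSlot_balabanData_rate`
   with row B4.d's hypothesis-free free tower BY NAME (`C₄ = C4data`, its `L^{−k}` defects majorised by `θ^k`).
WHAT IT IS FOR: with leaf-07-g3's part 1 (B2/B5 slot) and leaf-08-g2's part 2 (B3 summand), part 4 assembles `balaban_final_rate_of_regular_rate`
(R17 (c)): ROOT B fires at whatever rate `θ ∈ [L⁻¹, 1)` node NE3 eventually supplies.  WHAT IT IS NOT: no new estimate, nothing of node NE3, no B0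
(c5); ROOT B CONDITIONAL exactly as before.

HONEST FRAMING (T4-DAG p. 1).  Bookkeeping twins at MODEL LEVEL on OUR typed objects; constants OURS; NE2 (U1a) NOT proved; node NE3 OPEN; spine
PROVED 0/9 unchanged; rung (B)+1 on one finite T⁴ — NOT infinite volume, NOT mass gap, NOT Clay.  HONEST DEPENDENCY: continuum YM on T⁴ ⇐
BetaPertH ∧ nine spine estimates (0/9 proved); BetaPertH ⇐ (D1) ∧ (D4) ∧ CAP+tail; G-an2-4 gates asym, D1 and NE2/3/4.  ABSOLUTE RULE kept;
`GeomNumbersRate` is a hypothesis SHAPE (`structure … : Prop` on number sequences), no `def … : Prop` fact; no `sorry`.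
-/

noncomputable section

open scoped BigOperators ComplexConjugate Matrix Matrix.Norms.L2Operator Kronecker ComplexOrder

namespace Summit.QuantumFields.BalabanUV.T4Continuum.GaugeTermSlotRate

open Literature.MathematicalPhysics.QuantumFieldTheory.Balaban1983to89.B5Prop11Plancherel
open Literature.MathematicalPhysics.QuantumFieldTheory.Balaban1983to89.B5G183RateUnitTower (lev lev_neZero)
open Summit.QuantumFields.BalabanUV.T4Continuum
open Summit.QuantumFields.BalabanUV.T4Continuum.BalabanAveragedTowerUnit (idx Qlev one_le_lev' cast_lev')
open Summit.QuantumFields.BalabanUV.T4Continuum.BackgroundResolventTower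
open Summit.QuantumFields.BalabanUV.T4Continuum.BackgroundResolventLaw
open Summit.QuantumFields.BalabanUV.T4Continuum.KingPairingPlantedLaw
open Summit.QuantumFields.BalabanUV.T4Continuum.KroneckerLift
open Summit.QuantumFields.BalabanUV.T4Continuum.BlockMultiplication
open Summit.QuantumFields.BalabanUV.T4Continuum.BalabanAveragedTowerModes (par)
open Summit.QuantumFields.BalabanUV.T4Continuum.PerturbationAlgebra (perturbationLaws_mono perturbationLaws_zero)
open Summit.QuantumFields.BalabanUV.T4Continuum.GaugeTermDecomposition (covGrad defect connL opNorm_defect_le)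
open Summit.QuantumFields.BalabanUV.T4Continuum.GaugeTermSandwichLaw
open Summit.QuantumFields.BalabanUV.T4Continuum.GaugeTermLayer
open Summit.QuantumFields.BalabanUV.T4Continuum.GaugeTermPerturbationLaw
open Summit.QuantumFields.BalabanUV.T4Continuum.GaugeTermScalarData
open Summit.QuantumFields.BalabanUV.T4Continuum.GaugeTermInstance
open Summit.QuantumFields.BalabanUV.T4Continuum.GaugeTermInstanceGeom (CesS CecS CthetaS gS kappaGS C4S inv_cast_lev J0_eq_kron_J0pcT
  opNorm_siteMul_sub_one_le opNorm_siteMul_sub_siteMul_le)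
open Summit.QuantumFields.BalabanUV.T4Continuum.GaugeTermBalabanData (C4data connL_bound connL_lipschitz)
open Summit.QuantumFields.BalabanUV.T4Continuum.ScalarAveragedPropagator (DeltaPs Gps gammaPs gammaPs_pos)
open Summit.QuantumFields.BalabanUV.T4Continuum.ScalarAveragedCompression (sigma0)
open Summit.QuantumFields.BalabanUV.T4Continuum.ScalarCovariantLaplacian (Bs connS scalarPert kappaS opNorm_Bs_le)
open Summit.QuantumFields.BalabanUV.T4Continuum.ScalarCovariantLaplacianLaws (C2S ConnectionLaws0 SiteTransportLaws0)
open Summit.QuantumFields.BalabanUV.T4Continuum.ScalarCovariantLaplacianLawsRate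
open Summit.QuantumFields.BalabanUV.T4Continuum.ScalarPlantingDefect (Q0lev J0pcT)
open Summit.QuantumFields.BalabanUV.T4Continuum.EffectiveLaplacianExcess (CX freeTowerLaws_king_scalar)
open Summit.QuantumFields.BalabanUV.T4Continuum.BlockPairingGeometry (tau parT)
open Summit.QuantumFields.BalabanUV.T4Continuum.CovariantDivergencePlantingTower (JK0T JK0T_eq Pi0T planting_number_le)
open Summit.QuantumFields.BalabanUV.T4Continuum.NE2BalabanGauge

open Summit.QuantumFields.BalabanUV.T4Continuum.GaugeTermSlotRateNumbers

section SlotRate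

variable {d : ℕ} (L : ℕ) [NeZero L] (M : Fin d → ℕ) [hM : ∀ μ, NeZero (M μ)] (a : ℝ) (ha : 0 < a)
variable {o : Type*} [Fintype o] [DecidableEq o] {γ : Type*} [Fintype γ] [DecidableEq γ]

/-! ## §3 `LayerLaws` from the scalar tower's laws with a rate-`θ` connection consistency, and their ratio-`θ` numbers -/

variable (R : (k : ℕ) → Fin d → (Tor (fine (lev L k) M) → Matrix o o ℂ)) (T : (k : ℕ) → Tor (fine (lev L k) M) → Matrix o o ℂ) (a' : ℝ)

/-- **`LayerLaws` FROM THE SCALAR TOWER's LAWS, CONNECTION CONSISTENCY AT RATE `θ`** — `GaugeTermInstance.layerLaws_of_scalarLaws` VERBATIM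
except the planting field, whose two-spacing input is `hcons : … ≤ β′θ^k` and whose output is `thetaSR` (leaf-10's per-level
`planting_number_le` at the level-`k` constant `β′θ^k·n_k`). [folklore] -/
theorem layerLaws_of_scalarLaws_rate (ha' : 0 < a') (hd : 1 ≤ d) {θ : ℝ} (hθ0 : 0 ≤ θ)
    {A : (k : ℕ) → Matrix (Tor (fine (lev L k) M) × o) (Tor (fine (lev L (k + 1)) M) × o) ℂ}
    {F : (k : ℕ) → Matrix (Tor (fine (lev L k) M) × o) (Tor (fine (lev L k) M) × o) ℂ} {r : ℝ} {e₀ e₁ f e₂ δT : ℕ → ℝ}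
    {κs g α β β' τ : ℝ}
    (hfreeS : FreeTowerLaws (fun k => DeltaPs (lev L k) M a' ⊗ₖ (1 : Matrix o o ℂ)) A (J0 L M o) F r e₀ e₁ f)
    (hpertS : PerturbationLaws (fun k => DeltaPs (lev L k) M a' ⊗ₖ (1 : Matrix o o ℂ))
      (fun k => scalarPert (lev L k) M a' (R k) (T k)) (J0 L M o) κs e₂)
    (hκ : κs < 1) (hg : (gammaPs d a')⁻¹ * (1 - κs)⁻¹ ≤ g) (hα : 0 ≤ α) (hβ : 0 ≤ β) (hβ' : 0 ≤ β') (hτ : 0 ≤ τ)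
    (hR : ∀ k μ i, ‖connL (fine (lev L k) M) (cl L k) (R k) μ i‖ ≤ α)
    (hLip : ∀ k μ lam i, ‖connL (fine (lev L k) M) (cl L k) (R k) μ (tau (fine (lev L k) M) lam i)
      - connL (fine (lev L k) M) (cl L k) (R k) μ i‖ ≤ β / (lev L k : ℕ))
    (hcons : ∀ k μ (i' : Tor (fine (lev L (k + 1)) M) × Fin d),
      ‖connL (fine (lev L (k + 1)) M) (cl L (k + 1)) (R (k + 1)) μ i' - connL (fine (lev L k) M) (cl L k) (R k) μ (parT (lev L k) L M i')‖
        ≤ β' * θ ^ k)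
    (hT : ∀ k, ‖siteMul (T k) - 1‖ ≤ τ)
    (hTc : ∀ k, ‖siteMul (T (k + 1)) - siteMul (fun x' : Tor (fine (lev L (k + 1)) M) => T k (par (lev L k) L M x'))‖ ≤ δT k) :
    LayerLaws L M a ha R (QuT L M o T) a' (J0 L M o) g (1 + τ) (d * α) (esS κs e₁ e₂) (ecS κs e₀) (thetaSR d L a g α β β' θ (ecS κs e₀)) δT := by
  have hκ0 : 0 ≤ κs := (norm_nonneg _).trans (hpertS.opNorm_P_mul_inv_le 0)
  have ht : ‖(1 : ℂ)‖ * κs < 1 := by rw [norm_one, one_mul]; exact hκ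
  have hν : 0 ≤ (1 - κs)⁻¹ := inv_nonneg.mpr (by linarith)
  have hγ : 0 ≤ (gammaPs d a')⁻¹ := inv_nonneg.mpr (gammaPs_pos (d := d) (a' := a')).1.le
  have hgn : 0 ≤ g := (mul_nonneg hγ hν).trans hg
  have hD : ∀ k, IsUnit (DeltaPs (lev L k) M a' ⊗ₖ (1 : Matrix o o ℂ)).det := hfreeS.isUnit_det
  -- the family's resolvent is the perturbed free one
  have hG : ∀ k, Gop L M R (QuT L M o T) a' k
      = (DeltaPs (lev L k) M a' ⊗ₖ (1 : Matrix o o ℂ) + (1 : ℂ) • scalarPert (lev L k) M a' (R k) (T k))⁻¹ := fun k => by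
    rw [Gop, Sop_eq_add_scalarPert]
  have hGle : ∀ k, ‖Gop L M R (QuT L M o T) a' k‖ ≤ g := fun k => by
    rw [hG]
    refine (opNorm_inv_add_smul_le (hD k) (hpertS.opNorm_P_mul_inv_le k) ht).trans ?_
    rw [norm_one, one_mul]
    exact (mul_le_mul_of_nonneg_right (opNorm_inv_DeltaPs_kron_le L M ha' k) hν).trans hg
  have hBs : ∀ (n : ℕ) [NeZero n], ‖Bs o n M‖ ≤ 1 := fun n _ => opNorm_Bs_le o n M
  have hSite : ∀ k, ‖siteMul (T k)‖ ≤ 1 + τ := fun k => by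
    have e : siteMul (T k) = 1 + (siteMul (T k) - 1) := by abel
    rw [e]; exact (norm_add_le _ _).trans (add_le_add l2_opNorm_one_le (hT k))
  have hcompl : ∀ k, ‖Gop L M R (QuT L M o T) a' (k + 1) * (1 - J0 L M o k * (J0 L M o k)ᴴ)‖ ≤ ecS κs e₀ k := fun k => by
    have e : Gop L M R (QuT L M o T) a' (k + 1) * (1 - J0 L M o k * (J0 L M o k)ᴴ)
        = (Gop L M R (QuT L M o T) a' (k + 1) * (DeltaPs (lev L (k + 1)) M a' ⊗ₖ (1 : Matrix o o ℂ)))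
          * ((DeltaPs (lev L (k + 1)) M a' ⊗ₖ (1 : Matrix o o ℂ))⁻¹ * (1 - J0 L M o k * (J0 L M o k)ᴴ)) := by
      rw [Matrix.mul_assoc, ← Matrix.mul_assoc (DeltaPs _ M a' ⊗ₖ _), Matrix.mul_nonsing_inv _ (hD (k + 1)), Matrix.one_mul]
    rw [e, ecS]
    refine (Matrix.l2_opNorm_mul _ _).trans (mul_le_mul ?_ (hfreeS.complement_le k) (norm_nonneg _) hν)
    rw [hG]
    have h := opNorm_inv_add_smul_mul_le (hD (k + 1)) (hpertS.opNorm_inv_mul_P_le (k + 1)) ht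
    rwa [norm_one, one_mul] at h
  refine
    { nonneg := ⟨ha'.le, by linarith, mul_nonneg (Nat.cast_nonneg d) hα⟩
      isUnit_S := fun k => ?_
      opNorm_G_le := hGle
      opNorm_Q_le := fun k => ?_
      opNorm_defect_le := fun k => opNorm_defect_le (fine (lev L k) M) (cl L k) hα (hR k)
      injected_le := fun k => ?_
      complement_le := hcompl
      planting_le := fun k => ?_
      pairing_le := fun k => ?_ }
  · -- invertibility of `S_k = D_k + 1•P_k`
    rw [Sop_eq_add_scalarPert]
    exact isUnit_det_add_smul_right (hD k) (hpertS.opNorm_P_mul_inv_le k) ht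
  · -- `‖B·siteMul T‖ ≤ 1 + τ`
    rw [QuT]
    exact (Matrix.l2_opNorm_mul _ _).trans ((mul_le_mul (hBs (lev L k)) (hSite k) (norm_nonneg _) zero_le_one).trans (by rw [one_mul]))
  · -- the perturbed injected law on the scalar tower
    rw [hG, hG, esS]
    have h := perturbed_injected_law (J := J0 L M o k) (hD k) (hD (k + 1)) (hpertS.opNorm_P_mul_inv_le k)
      (hpertS.opNorm_inv_mul_P_le (k + 1)) ht (hfreeS.injected_le k) (hpertS.consistent_le k)
    rwa [norm_one, one_mul, one_mul] at h
  · -- the planting number (row B4.f)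
    have hcomp : ‖Gop L M R (QuT L M o T) a' (k + 1) * ((1 - Pi0T L M k) ⊗ₖ (1 : Matrix o o ℂ))‖ ≤ ecS κs e₀ k := by
      rw [one_sub_Pi0T_kron]; exact hcompl k
    have hec : 0 ≤ ecS κs e₀ k := (norm_nonneg _).trans (hcompl k)
    -- leaf-10's per-level planting number with the level-`k` two-spacing constant `β′θ^k·n_k` (so that `(β′θ^k·n_k)/n_k = β′θ^k`)
    have hn : (0 : ℝ) < (lev L k : ℕ) := by exact_mod_cast one_le_lev' L k
    have hβk : 0 ≤ β' * θ ^ k * (lev L k : ℕ) := mul_nonneg (mul_nonneg hβ' (pow_nonneg hθ0 k)) hn.le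
    have hconsk : ∀ μ (i' : Tor (fine (lev L (k + 1)) M) × Fin d),
        ‖connL (fine (lev L (k + 1)) M) (cl L (k + 1)) (R (k + 1)) μ i' - connL (fine (lev L k) M) (cl L k) (R k) μ (parT (lev L k) L M i')‖
          ≤ β' * θ ^ k * (lev L k : ℕ) / (lev L k : ℕ) := fun μ i' => by
      rw [mul_div_assoc, div_self hn.ne', mul_one]; exact hcons k μ i'
    refine (planting_number_le L M a ha hd R k hα hβ hβk hgn hec (hR k) (hLip k) hconsk (hGle (k + 1)) hcomp).trans (le_of_eq ?_)
    unfold thetaSR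
    rw [add_div' _ _ _ hn.ne']
    ring
  · -- the pairing of the transported averaging with the planting
    have e : QuT L M o T (k + 1) * J0 L M o k - QuT L M o T k
        = Bs o (lev L (k + 1)) M * (siteMul (T (k + 1)) - siteMul (fun x' : Tor (fine (lev L (k + 1)) M) => T k (par (lev L k) L M x')))
          * J0 L M o k := by
      rw [QuT, QuT, ← Bs_succ_mul_J0 L M (o := o) k, Matrix.mul_sub, Matrix.sub_mul, Matrix.mul_assoc, Matrix.mul_assoc,
        Matrix.mul_assoc, J0_mul_siteMul]
    rw [e]
    calc _ ≤ ‖Bs o (lev L (k + 1)) M * (siteMul (T (k + 1)) - siteMul (fun x' : Tor (fine (lev L (k + 1)) M) => T k (par (lev L k) L M x')))‖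
            * ‖J0 L M o k‖ := Matrix.l2_opNorm_mul _ _
      _ ≤ (1 * δT k) * 1 := mul_le_mul ((Matrix.l2_opNorm_mul _ _).trans (mul_le_mul (hBs (lev L (k + 1))) (hTc k) (norm_nonneg _)
            zero_le_one)) (hfreeS.opNorm_J_le k) (norm_nonneg _) (by have := (norm_nonneg _).trans (hTc k); positivity)
      _ = δT k := by ring

/-- **THE NUMBERS ARE RATIO-`θ`**: `GeomNumbersRate θ` for the four sequences of `layerLaws_of_scalarLaws_rate` from ratio-`θ` defects
`e₀ e₁ e₂ δT` (nonnegative; `κs < 1`; `L⁻¹ ≤ θ` for the planting's Lipschitz part; `g, α, β ≥ 0`). [folklore] -/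
theorem geomNumbersRate_of_defects {e₀ e₁ e₂ δT : ℕ → ℝ} {κs g α β β' θ C₀ C₁ C₂ CT : ℝ} (hκ : κs < 1)
    (hg : 0 ≤ g) (hα : 0 ≤ α) (hβ : 0 ≤ β) (hθ : ((L : ℝ)⁻¹) ≤ θ)
    (he₀0 : ∀ k, 0 ≤ e₀ k) (he₁0 : ∀ k, 0 ≤ e₁ k) (he₂0 : ∀ k, 0 ≤ e₂ k) (hδT0 : ∀ k, 0 ≤ δT k)
    (he₀ : ∀ k, e₀ k ≤ C₀ * θ ^ k) (he₁ : ∀ k, e₁ k ≤ C₁ * θ ^ k) (he₂ : ∀ k, e₂ k ≤ C₂ * θ ^ k)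
    (hδT : ∀ k, δT k ≤ CT * θ ^ k) :
    GeomNumbersRate θ (esS κs e₁ e₂) (ecS κs e₀) (thetaSR d L a g α β β' θ (ecS κs e₀)) δT
      (CesS κs C₁ C₂) (CecS κs C₀) (CthetaS d L a g α β β' (CecS κs C₀)) CT where
  es_nonneg k := by unfold esS; have := he₁0 k; have := he₂0 k; positivity
  ec_nonneg k := by
    unfold ecS; exact mul_nonneg (inv_nonneg.mpr (by linarith)) (he₀0 k)
  q₁_nonneg := hδT0
  es_le := esS_le_geom_rate he₁ he₂
  ec_le := ecS_le_geom_rate hκ he₀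
  θ_le := thetaSR_le_geom hg hα hβ hθ (ecS_le_geom_rate hκ he₀)
  q₁_le := hδT

/-! ## §4 The ENDs at rate `θ` -/

/-- **`PerturbationLaws` FOR THE GAUGE SLOT FROM THE SCALAR TOWER AT RATE `θ`** (`a′ > 0`, `d ≥ 1`, `L⁻¹ ≤ θ ≤ 1`): ratio-`θ` defects
`e₀ e₁ e₂ δT ≤ C·θ^k`, connection consistency `β′θ^k`, and `σ₀⁻²·δK < 1` ⟹ the target shape for `gaugeSlot R Q_U Q_1 a′` with
`κ₄ = kappaGS`, `C₄ = C4S` (UNCHANGED letters) and majorant `C4S·θ^k` — `GaugeTermInstanceGeom.perturbationLaws_gaugeSlot_scalar` at rate `θ`.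
NOT NE2; model level. [folklore] -/
theorem perturbationLaws_gaugeSlot_scalar_rate (ha' : 0 < a') (hd : 1 ≤ d)
    {A : (k : ℕ) → Matrix (Tor (fine (lev L k) M) × o) (Tor (fine (lev L (k + 1)) M) × o) ℂ}
    {F : (k : ℕ) → Matrix (Tor (fine (lev L k) M) × o) (Tor (fine (lev L k) M) × o) ℂ} {r : ℝ} {e₀ e₁ f e₂ δT : ℕ → ℝ}
    {κs α β β' τ θ C₀ C₁ C₂ CT : ℝ}
    (hfree : FreeTowerLaws (fun k => DeltaPs (lev L k) M a' ⊗ₖ (1 : Matrix o o ℂ)) A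
      (fun k => J0pcT L M k ⊗ₖ (1 : Matrix o o ℂ)) F r e₀ e₁ f)
    (hpert : PerturbationLaws (fun k => DeltaPs (lev L k) M a' ⊗ₖ (1 : Matrix o o ℂ))
      (fun k => scalarPert (lev L k) M a' (R k) (T k)) (fun k => J0pcT L M k ⊗ₖ (1 : Matrix o o ℂ)) κs e₂)
    (hκ : κs < 1) (hα : 0 ≤ α) (hβ : 0 ≤ β) (hβ' : 0 ≤ β') (hτ : 0 ≤ τ) (hθ : ((L : ℝ)⁻¹) ≤ θ) (hθle : θ ≤ 1)
    (hR : ∀ k μ i, ‖connL (fine (lev L k) M) (cl L k) (R k) μ i‖ ≤ α)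
    (hLip : ∀ k μ lam i, ‖connL (fine (lev L k) M) (cl L k) (R k) μ (tau (fine (lev L k) M) lam i)
      - connL (fine (lev L k) M) (cl L k) (R k) μ i‖ ≤ β / (lev L k : ℕ))
    (hcons : ∀ k μ (i' : Tor (fine (lev L (k + 1)) M) × Fin d),
      ‖connL (fine (lev L (k + 1)) M) (cl L (k + 1)) (R (k + 1)) μ i' - connL (fine (lev L k) M) (cl L k) (R k) μ (parT (lev L k) L M i')‖
        ≤ β' * θ ^ k)
    (hT : ∀ k, ‖siteMul (T k) - 1‖ ≤ τ)
    (hTc : ∀ k, ‖siteMul (T (k + 1)) - siteMul (fun x' : Tor (fine (lev L (k + 1)) M) => T k (par (lev L k) L M x'))‖ ≤ δT k)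
    (he₀ : ∀ k, e₀ k ≤ C₀ * θ ^ k) (he₁ : ∀ k, e₁ k ≤ C₁ * θ ^ k) (he₂ : ∀ k, e₂ k ≤ C₂ * θ ^ k)
    (hδT : ∀ k, δT k ≤ CT * θ ^ k)
    (hsmall : ((sigma0 d a') ^ 2)⁻¹ * deltaK (gS d a' κs) (1 + τ) (d * α) τ a' < 1) :
    PerturbationLaws (fun k => calDalev L M a ha k ⊗ₖ (1 : Matrix o o ℂ)) (gaugeSlot L M R (QuT L M o T) (Q1 L M o) a')
      (fun k => JpcT L M k ⊗ₖ (1 : Matrix o o ℂ)) (kappaGS d a a' κs α τ)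
      (fun k => C4S d L a a' κs α β β' τ C₀ C₁ C₂ CT * θ ^ k) := by
  have hθ0 : (0 : ℝ) ≤ θ := (inv_nonneg.mpr (Nat.cast_nonneg L)).trans hθ
  have hJ := J0_eq_kron_J0pcT L M (o := o)
  have hfreeS : FreeTowerLaws (fun k => DeltaPs (lev L k) M a' ⊗ₖ (1 : Matrix o o ℂ)) A (J0 L M o) F r e₀ e₁ f := by
    rw [hJ]; exact hfree
  have hpertS : PerturbationLaws (fun k => DeltaPs (lev L k) M a' ⊗ₖ (1 : Matrix o o ℂ))
      (fun k => scalarPert (lev L k) M a' (R k) (T k)) (J0 L M o) κs e₂ := by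
    rw [hJ]; exact hpert
  have hκ0 : 0 ≤ κs := (norm_nonneg _).trans (hpertS.opNorm_P_mul_inv_le 0)
  have hδT0 : ∀ k, 0 ≤ δT k := fun k => (norm_nonneg _).trans (hTc k)
  have he₀0 : ∀ k, 0 ≤ e₀ k := fun k => (norm_nonneg _).trans (hfreeS.complement_le k)
  have he₁0 : ∀ k, 0 ≤ e₁ k := fun k => (norm_nonneg _).trans (hfreeS.injected_le k)
  have he₂0 : ∀ k, 0 ≤ e₂ k := fun k => (norm_nonneg _).trans (hpertS.consistent_le k)
  have hgn : 0 ≤ gS d a' κs := mul_nonneg (inv_nonneg.mpr (gammaPs_pos (d := d) (a' := a')).1.le) (inv_nonneg.mpr (by linarith))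
  -- the background family
  have hu := layerLaws_of_scalarLaws_rate L M a ha R T a' ha' hd hθ0 hfreeS hpertS hκ le_rfl hα hβ hβ' hτ hR hLip hcons hT hTc
  -- the free family: same numbers, zero connection, trivial transport
  have h₁' := layerLaws_of_scalarLaws_rate L M a ha (oneR L M (o := o)) (fun k (_ : Tor (fine (lev L k) M)) => (1 : Matrix o o ℂ)) a' ha' hd
    hθ0 hfreeS (perturbationLaws_free_scalar L M a' hκ0 (J0 L M o)) hκ le_rfl hα hβ hβ' hτ
    (fun k μ i => by rw [connL_oneR, norm_zero]; exact hα)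
    (fun k μ lam i => by
      rw [connL_oneR, connL_oneR, sub_zero, norm_zero]; exact div_nonneg hβ (Nat.cast_nonneg _))
    (fun k μ i' => by
      rw [connL_oneR, connL_oneR, sub_zero, norm_zero]; exact mul_nonneg hβ' (pow_nonneg hθ0 k))
    (fun k => by simp only [siteMul_one, sub_self, norm_zero]; exact hτ)
    (fun k => by simp only [siteMul_one, sub_self, norm_zero]; exact hδT0 k)
  rw [QuT_one] at h₁'
  -- both families' numbers are ratio-`θ`
  have hGu := geomNumbersRate_of_defects (d := d) (L := L) (a := a) (g := gS d a' κs) (α := α) (β := β) (β' := β') hκ hgn hα hβ hθ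
    he₀0 he₁0 he₂0 hδT0 he₀ he₁ he₂ hδT
  have hG₁ := geomNumbersRate_of_defects (d := d) (L := L) (a := a) (g := gS d a' κs) (α := α) (β := β) (β' := β')
    (e₂ := fun _ => (0 : ℝ)) (C₂ := 0) hκ hgn hα hβ hθ he₀0 he₁0 (fun _ => le_rfl) hδT0 he₀ he₁ (fun k => by rw [zero_mul]) hδT
  exact perturbationLaws_gaugeSlot_rate L M a ha hu h₁' (opNorm_QuT_sub_Q1_le L M T hT)
    (fun k => (unitDatum_one L M a' ha' k).1) (fun k => (unitDatum_one L M a' ha' k).2) hsmall hθ hθle hGu hG₁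

/-- **§4 WITH THE SITE-TRANSPORT BINDERS ENTRYWISE AT RATE `θ`** — `‖T k x − 1‖ ≤ τ`, `‖T (k+1) x′ − T k (par x′)‖ ≤ τ′·θ^k` (the field shapes of
part 3a's `SiteTransportLaws0Rate`; `δT k = τ′θ^k`, `CT = τ′`).  NOT NE2; model level. [folklore] -/
theorem perturbationLaws_gaugeSlot_scalar_site_rate (ha' : 0 < a') (hd : 1 ≤ d)
    {A : (k : ℕ) → Matrix (Tor (fine (lev L k) M) × o) (Tor (fine (lev L (k + 1)) M) × o) ℂ}
    {F : (k : ℕ) → Matrix (Tor (fine (lev L k) M) × o) (Tor (fine (lev L k) M) × o) ℂ} {r : ℝ} {e₀ e₁ f e₂ : ℕ → ℝ}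
    {κs α β β' τ τ' θ C₀ C₁ C₂ : ℝ}
    (hfree : FreeTowerLaws (fun k => DeltaPs (lev L k) M a' ⊗ₖ (1 : Matrix o o ℂ)) A
      (fun k => J0pcT L M k ⊗ₖ (1 : Matrix o o ℂ)) F r e₀ e₁ f)
    (hpert : PerturbationLaws (fun k => DeltaPs (lev L k) M a' ⊗ₖ (1 : Matrix o o ℂ))
      (fun k => scalarPert (lev L k) M a' (R k) (T k)) (fun k => J0pcT L M k ⊗ₖ (1 : Matrix o o ℂ)) κs e₂)
    (hκ : κs < 1) (hα : 0 ≤ α) (hβ : 0 ≤ β) (hβ' : 0 ≤ β') (hτ : 0 ≤ τ) (hτ' : 0 ≤ τ') (hθ : ((L : ℝ)⁻¹) ≤ θ) (hθle : θ ≤ 1)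
    (hR : ∀ k μ i, ‖connL (fine (lev L k) M) (cl L k) (R k) μ i‖ ≤ α)
    (hLip : ∀ k μ lam i, ‖connL (fine (lev L k) M) (cl L k) (R k) μ (tau (fine (lev L k) M) lam i)
      - connL (fine (lev L k) M) (cl L k) (R k) μ i‖ ≤ β / (lev L k : ℕ))
    (hcons : ∀ k μ (i' : Tor (fine (lev L (k + 1)) M) × Fin d),
      ‖connL (fine (lev L (k + 1)) M) (cl L (k + 1)) (R (k + 1)) μ i' - connL (fine (lev L k) M) (cl L k) (R k) μ (parT (lev L k) L M i')‖
        ≤ β' * θ ^ k)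
    (hT : ∀ k x, ‖T k x - 1‖ ≤ τ)
    (hTc : ∀ k (x' : Tor (fine (lev L (k + 1)) M)), ‖T (k + 1) x' - T k (par (lev L k) L M x')‖ ≤ τ' * θ ^ k)
    (he₀ : ∀ k, e₀ k ≤ C₀ * θ ^ k) (he₁ : ∀ k, e₁ k ≤ C₁ * θ ^ k) (he₂ : ∀ k, e₂ k ≤ C₂ * θ ^ k)
    (hsmall : ((sigma0 d a') ^ 2)⁻¹ * deltaK (gS d a' κs) (1 + τ) (d * α) τ a' < 1) :
    PerturbationLaws (fun k => calDalev L M a ha k ⊗ₖ (1 : Matrix o o ℂ)) (gaugeSlot L M R (QuT L M o T) (Q1 L M o) a')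
      (fun k => JpcT L M k ⊗ₖ (1 : Matrix o o ℂ)) (kappaGS d a a' κs α τ)
      (fun k => C4S d L a a' κs α β β' τ C₀ C₁ C₂ τ' * θ ^ k) := by
  have hθ0 : (0 : ℝ) ≤ θ := (inv_nonneg.mpr (Nat.cast_nonneg L)).trans hθ
  exact perturbationLaws_gaugeSlot_scalar_rate L M a ha R T a' ha' hd hfree hpert hκ hα hβ hβ' hτ hθ hθle hR hLip hcons
    (fun k => opNorm_siteMul_sub_one_le hτ (hT k))
    (fun k => opNorm_siteMul_sub_siteMul_le (mul_nonneg hτ' (pow_nonneg hθ0 k)) (hTc k))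
    he₀ he₁ he₂ (fun k => le_rfl) hsmall

variable {R T a'}

/-- **THE GAUGE SLOT ON ROW B4.e's RATE-`θ` DATA STRUCTURES** (`d ≥ 1`, `a′ > 0`, `L⁻¹ ≤ θ ≤ 1`): the free scalar tower laws (row B4.d shape;
free defects `e₀ k ≤ C₀θ^k`, `e₁ k ≤ C₁θ^k`), part 3a's `ConnectionLaws0Rate` / `SiteTransportLaws0Rate` (row B4.e's END at rate `θ` BY NAME,
`perturbationLaws_scalarLayer_rate`, supplies `e₂ = e2SR ≤ C2S·θ^k`), `kappaS < 1` and `σ₀⁻²·δK < 1` ⟹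
`PerturbationLaws (Δ_a ⊗ 1) (gaugeSlot R (QuT T) Q1 a′) (J ⊗ 1) (kappaGS …) (k ↦ C4S … (C2S …) τ′ · θ^k)` —
`GaugeTermBalabanData.perturbationLaws_gaugeSlot_data`'s statement with `θ` for `L⁻¹`, SAME letters.  NOT NE2; model level. [folklore] -/
theorem perturbationLaws_gaugeSlot_data_rate (hd : 1 ≤ d) (ha' : 0 < a')
    {A : (k : ℕ) → Matrix (Tor (fine (lev L k) M) × o) (Tor (fine (lev L (k + 1)) M) × o) ℂ}
    {F : (k : ℕ) → Matrix (Tor (fine (lev L k) M) × o) (Tor (fine (lev L k) M) × o) ℂ} {r : ℝ} {e₀ e₁ f : ℕ → ℝ} {C₀ C₁ θ : ℝ}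
    (hfree : FreeTowerLaws (fun k => DeltaPs (lev L k) M a' ⊗ₖ (1 : Matrix o o ℂ)) A
      (fun k => J0pcT L M k ⊗ₖ (1 : Matrix o o ℂ)) F r e₀ e₁ f)
    (he₀ : ∀ k, e₀ k ≤ C₀ * θ ^ k) (he₁ : ∀ k, e₁ k ≤ C₁ * θ ^ k)
    {α β β' ζ τ τ' : ℝ} (hR : ConnectionLaws0Rate L M R α β β' ζ θ) (hT : SiteTransportLaws0Rate L M T τ τ' θ)
    (hθ : ((L : ℝ)⁻¹) ≤ θ) (hθle : θ ≤ 1) (hκ : kappaS d a' α β τ < 1)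
    (hsmall : ((sigma0 d a') ^ 2)⁻¹ * deltaK (gS d a' (kappaS d a' α β τ)) (1 + τ) (d * α) τ a' < 1) :
    PerturbationLaws (fun k => calDalev L M a ha k ⊗ₖ (1 : Matrix o o ℂ)) (gaugeSlot L M R (QuT L M o T) (Q1 L M o) a')
      (fun k => JpcT L M k ⊗ₖ (1 : Matrix o o ℂ)) (kappaGS d a a' (kappaS d a' α β τ) α τ)
      (fun k => C4S d L a a' (kappaS d a' α β τ) α β β' τ C₀ C₁ (C2S d L a' α β β' ζ τ τ' C₀ C₁) τ' * θ ^ k) := by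
  have hθ0 : (0 : ℝ) ≤ θ := (inv_nonneg.mpr (Nat.cast_nonneg L)).trans hθ
  exact perturbationLaws_gaugeSlot_scalar_site_rate L M a ha R T a' ha' hd hfree (perturbationLaws_scalarLayer_rate L M hd ha' hfree hθ0 hR hT) hκ
    hR.nonneg.1 hR.nonneg.2.1 hR.nonneg.2.2.1 hT.nonneg.1 hT.nonneg.2 hθ hθle
    (fun k μ i => hR.bound k μ i.1) (fun k μ lam i => hR.lipschitz k μ lam i.1) (fun k μ i' => hR.consistent k μ i'.1)
    hT.sub_one_le hT.consistent he₀ he₁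
    (e2SR_le_geom L ha' hR.nonneg.1 hR.nonneg.2.1 hT.nonneg.1 he₀ he₁) hsmall

/-- **CONSISTENCY WITH THE INSTANCE OF RECORD (kernel)**: at `θ = L⁻¹`, fed the LANDED shapes through part 3a's `…_of_lev` lemmas, the rate-`θ`
END has EXACTLY the type of `GaugeTermBalabanData.perturbationLaws_gaugeSlot_data` (same `κ`, same `C4S … * L⁻¹^k`) — the instance of record is
the special case, letter for letter. -/
example (hd : 1 ≤ d) (ha' : 0 < a')
    {A : (k : ℕ) → Matrix (Tor (fine (lev L k) M) × o) (Tor (fine (lev L (k + 1)) M) × o) ℂ}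
    {F : (k : ℕ) → Matrix (Tor (fine (lev L k) M) × o) (Tor (fine (lev L k) M) × o) ℂ} {r : ℝ} {e₀ e₁ f : ℕ → ℝ} {C₀ C₁ : ℝ}
    (hfree : FreeTowerLaws (fun k => DeltaPs (lev L k) M a' ⊗ₖ (1 : Matrix o o ℂ)) A
      (fun k => J0pcT L M k ⊗ₖ (1 : Matrix o o ℂ)) F r e₀ e₁ f)
    (he₀ : ∀ k, e₀ k ≤ C₀ * ((L : ℝ)⁻¹) ^ k) (he₁ : ∀ k, e₁ k ≤ C₁ * ((L : ℝ)⁻¹) ^ k)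
    {α β β' ζ τ τ' : ℝ} (hR : ConnectionLaws0 L M R α β β' ζ) (hT : SiteTransportLaws0 L M T τ τ')
    (hκ : kappaS d a' α β τ < 1)
    (hsmall : ((sigma0 d a') ^ 2)⁻¹ * deltaK (gS d a' (kappaS d a' α β τ)) (1 + τ) (d * α) τ a' < 1) :
    PerturbationLaws (fun k => calDalev L M a ha k ⊗ₖ (1 : Matrix o o ℂ)) (gaugeSlot L M R (QuT L M o T) (Q1 L M o) a')
      (fun k => JpcT L M k ⊗ₖ (1 : Matrix o o ℂ)) (kappaGS d a a' (kappaS d a' α β τ) α τ)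
      (fun k => C4S d L a a' (kappaS d a' α β τ) α β β' τ C₀ C₁ (C2S d L a' α β β' ζ τ τ' C₀ C₁) τ' * ((L : ℝ)⁻¹) ^ k) :=
  perturbationLaws_gaugeSlot_data_rate L M a ha hd ha' hfree he₀ he₁ (connectionLaws0Rate_of_lev hR) (siteTransportLaws0Rate_of_lev hT)
    le_rfl (inv_le_one_of_one_le₀ (by exact_mod_cast Nat.one_le_iff_ne_zero.mpr (NeZero.ne L))) hκ hsmall

/-- **THE GAUGE SLOT WITH EVERY BINDER A ROW's DATA SHAPE, AT RATE `θ`** (`d ≥ 1`, `a′ > 0`, `L⁻¹ ≤ θ ≤ 1`): §4 with row B4.d's hypothesis-free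
free scalar tower `freeTowerLaws_king_scalar` BY NAME (its King defects `C·L^{−k}` majorised by `C·θ^k`); constants `kappaGS …`, `C4data …` =
the instance of record's letters.  NOT NE2; model level. [folklore] -/
theorem perturbationLaws_gaugeSlot_balabanData_rate (hd : 1 ≤ d) (ha' : 0 < a')
    {α β β' ζ τ τ' θ : ℝ} (hR : ConnectionLaws0Rate L M R α β β' ζ θ) (hT : SiteTransportLaws0Rate L M T τ τ' θ)
    (hθ : ((L : ℝ)⁻¹) ≤ θ) (hθle : θ ≤ 1) (hκ : kappaS d a' α β τ < 1)
    (hsmall : ((sigma0 d a') ^ 2)⁻¹ * deltaK (gS d a' (kappaS d a' α β τ)) (1 + τ) (d * α) τ a' < 1) :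
    PerturbationLaws (fun k => calDalev L M a ha k ⊗ₖ (1 : Matrix o o ℂ)) (gaugeSlot L M R (QuT L M o T) (Q1 L M o) a')
      (fun k => JpcT L M k ⊗ₖ (1 : Matrix o o ℂ)) (kappaGS d a a' (kappaS d a' α β τ) α τ)
      (fun k => C4data d L a a' α β β' ζ τ τ' * θ ^ k) := by
  have hγ : 0 ≤ 2 * d * Real.sqrt ((gammaPs d a')⁻¹) := by positivity
  have hX : 0 ≤ 2 * d * Real.sqrt ((gammaPs d a')⁻¹) + CX d a' := add_nonneg hγ (EffectiveLaplacianExcess.CX_nonneg d a')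
  exact perturbationLaws_gaugeSlot_data_rate L M a ha hd ha'
    (freeTowerLaws_kron o (freeTowerLaws_king_scalar L M (Nat.lt_of_lt_of_le Nat.zero_lt_one hd) ha'))
    (const_mul_invPow_le_pow (L := L) hγ hθ) (const_mul_invPow_le_pow (L := L) hX hθ) hR hT hθ hθle hκ hsmall

end SlotRate

end Summit.QuantumFields.BalabanUV.T4Continuum.GaugeTermSlotRate

end
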